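import Summits.BirchSwinnertonDyer.BirchSwinnertonDyer.Theorems.Rank1ResidualX1Converse
import Literature.NumberTheory.EllipticCurves.Rank1Residual.EisensteinGoodComplement
import HarnessLib

/-!
# Residual class X1 ∩ {r = 0} (ANOMALOUS good Eisenstein prime, rank 0): the sub-cell STATEMENT

HONEST FRAMING (cell `b2b-bsdres`, run/shared/lean/b2b/bsd-rank1-residual/, verbatim in every
file): the goal of the cell is to DELETE the COMBINATION-SHAPED residual classes of the
Birch–Swinnerton-Dyer formula for ALL analytic-rank `≤ 1` elliptic curves over `ℚ` — "full BSD
formula for every rank `≤ 1` curve in class `C`" assembled STRICTLY from published theorems — so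
that the rank-`≤ 1` remainder becomes exactly the CONSTRUCTION-SHAPED classes, which are TYPED
(missing-input `Prop`s), NOT attempted. This is not "finishing BSD". CLASS-OWNERS.md (2026-08-19):
the new prover sub-cells are RESEARCH ROUTES; NO CLAIM BEYOND STATED CLASSES.

Sub-cell `b2b-bsdres-eisenstein-p1` = PARTITION.md §3 row 18 ∩ {r = 0}: `p` odd, good, `E[p]`
reducible, `a_p ≡ 1 (mod p)` (anomalous), analytic rank `0`, and NOT the Greenberg–Vatsal parity
(`¬ gvpar`, "type A": the unramified-at-`p` constituent of `E[p]^{ss}` is EVEN — e.g. `11a1@5`,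
`14a1@3`, `26b1@7`, every curve with a rational `p`-torsion point at a good `p > 2`). This file is
the STATEMENT FILE the referee asked for (CLASS-OWNERS.md row "X1 (r=0)": "Lean STATEMENT file
first"). It asserts NOTHING: two definitions and bookkeeping theorems over decls already in the tree.

* `Leaf W p` — the leaf predicate, LITERALLY the tree class: `ClassX1 W p ∧ W.analyticRank = 0`
  (`Rank1Residual.ClassX1 W p := 2 < p ∧ Red W p ∧ Good W p ∧ Anom W p ∧ ¬(r = 0 ∧ GVPar W p)`,
  `Literature/…/Rank1Residual/Predicates.lean`); `leaf_iff` unfolds it to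
  `2 < p ∧ Red ∧ Good ∧ Anom ∧ ¬GVPar ∧ r = 0` (on `r = 0` the class clause IS type A).
* `Statement` — the sub-cell TARGET: `∀ W p, Leaf W p → BSDp W p` (Miller's `BSD(E,p)`). NOT a
  theorem of the published record (RESIDUAL-CASES §a.2 X1; FRESHNESS.md: reached only by the
  PREPRINT Keller–Yin arXiv:2402.12781v2); `@[conjecture]`-free because it is a bare `def … : Prop`
  consumed only as a hypothesis.
* Kernel links, all by NAME to landed decls (x1a/x1b seats): `statement_iff_classForm` (= the
  rank-`0` half of `Rank1ResidualX1Defs.BSDpOnClassX1`), `statement_of_bsdpOnClassX1`,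
  `statement_iff_forall_mazurMainConjecture` (granted the PUBLISHED facts Wuthrich 2014 Thm. 16,
  Greenberg 1999 Thm. 4.1, modularity, Gross–Zagier–Kolyvagin: `Statement` ⟺ Mazur's cyclotomic
  main conjecture `MazurMainConjecture W p` at EVERY leaf pair — x1b's kernel iff
  `Rank1Residual.X1.forall_mainConjecture_iff_forall_bsdp`; so the missing input of this sub-cell is
  EXACTLY "Mazur's main conjecture at an anomalous Eisenstein prime of type A, rank 0", x1a link
  L10 / `MazurMainConjectureOnX1TypeA`), `statement_iff_typeA`;
  the COVERED NEIGHBOURS at `r = 0` by name: `bsdp_of_not_leaf` (good Eisenstein `p > 2`, `r = 0`,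
  off the leaf ⇒ `BSDp`, = C6 Castella–Grossi–Skinner 2025 Thm. D (`¬anom`) ∪ C7 Greenberg–Vatsal
  2000 Thm. 1.3 + Greenberg 1999 Thm. 4.1 + Kato (`gvpar`), tree `Rank1Residual.bsdp_of_not_classX1`),
  `bsdp_or_leaf` (the rank-`0` good-Eisenstein dichotomy), `bsdp_goodEisenstein_rankZero_of_statement`.

Where the sub-cell's research goes (no Lean content; HOME/b2b-bsdres-eisenstein-p1/X1R0-GAPMAP.md):
the lemma-level location of the hypothesis `φ|_{G_p} ≠ 1, ω` in Castella–Grossi–Skinner 2025 /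
Castella–Grossi–Lee–Skinner 2022 and of the parity hypothesis in Greenberg–Vatsal 2000 §§2–3, and
the two unwritten items W1 (lattice) / W2 (torsion) of x1a's X1-RESEARCH-BRIEF.md.

References: RESIDUAL-CASES.md §a.2 X1; PARTITION.md §3 row 18; [KellerYin2024] Thm. 4.2.1 (PRE);
[CastellaGrossiSkinner2025] Thms. A, D; [GreenbergVatsal2000] Thm. (1.3); [GreenbergLNM1716] Thm. 4.1;
[Wuthrich2014] Thm. 16, Prop. 21; [Miller2011LMS] Def. 1.1.
-/

noncomputable section

open scoped Classical

open WeierstrassCurve Literature.NumberTheory.EllipticCurves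
  Literature.NumberTheory.EllipticCurves.ModularForms
  Literature.NumberTheory.EllipticCurves.Rank1Residual
  Summit.BirchSwinnertonDyer.BirchSwinnertonDyer.Theorems.Rank1ResidualX1Defs
  Summit.BirchSwinnertonDyer.BirchSwinnertonDyer.Theorems.Rank1ResidualX1Converse

set_option autoImplicit false

namespace Summit.BirchSwinnertonDyer.Rank1Residual.X1.RankZero

/-! ### The leaf predicate and the sub-cell statement -/

/-- **The leaf of sub-cell `eisenstein-p1`** (PARTITION.md §3 row 18 ∩ {r = 0}): the pair `(E, p)`
is in residual class X1 (tree predicate `Rank1Residual.ClassX1`, RESIDUAL-CASES §a.2 v3 verbatim)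
AND `ord_{s=1} L(E,s) = 0`. Literally the tree class, conjoined with the rank — no re-typing.
[folklore] -/
def Leaf (W : WeierstrassCurve ℚ) [W.IsGloballyMinimal] (p : ℕ) [Fact p.Prime] : Prop :=
  ClassX1 W p ∧ W.analyticRank = 0

/-- **The sub-cell TARGET (research route; NO CLAIM):** for every globally minimal elliptic `W/ℚ`
and prime `p` on the leaf, Miller's `BSD(E,p)`. Announced (Keller–Yin arXiv:2402.12781v2 Thm. 3 =
Thm. 4.2.1, PREPRINT); not a theorem of the published record. Consumed only as a hypothesis.
[cite: KellerYin2024, Thm. 4.2.1 (announced statement; shape only; nothing asserted)] -/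
@[conjecture] def Statement : Prop :=
  ∀ (W : WeierstrassCurve ℚ) [W.IsElliptic] [W.IsGloballyMinimal] (p : ℕ) [Fact p.Prime],
    Leaf W p → BSDp W p

variable {W : WeierstrassCurve ℚ} [W.IsGloballyMinimal] {p : ℕ} [Fact p.Prime]

/-- Unfolding of the leaf: `p > 2`, `E[p]` reducible, good reduction, anomalous (`a_p ≡ 1 (mod p)`),
NOT the Greenberg–Vatsal parity (type A), analytic rank `0`. On `r = 0` the class clause
`¬(r = 0 ∧ gvpar)` is exactly `¬gvpar`. [folklore] -/
theorem leaf_iff : Leaf W p ↔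
    2 < p ∧ Red W p ∧ Good W p ∧ Anom W p ∧ ¬ GVPar W p ∧ W.analyticRank = 0 := by
  constructor
  · rintro ⟨⟨hp, hred, hgood, hanom, hng⟩, hr0⟩
    exact ⟨hp, hred, hgood, hanom, fun hgv ↦ hng ⟨hr0, hgv⟩, hr0⟩
  · rintro ⟨hp, hred, hgood, hanom, hng, hr0⟩
    exact ⟨⟨hp, hred, hgood, hanom, fun h ↦ hng h.2⟩, hr0⟩

/-- A leaf pair is an X1 pair. [folklore] -/
theorem Leaf.classX1 (h : Leaf W p) : ClassX1 W p := h.1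

/-- A leaf pair has analytic rank `0`. [folklore] -/
theorem Leaf.analyticRank_eq_zero (h : Leaf W p) : W.analyticRank = 0 := h.2

/-- A leaf pair is of parity type A (`¬ gvpar`). [folklore] -/
theorem Leaf.not_gvPar (h : Leaf W p) : ¬ GVPar W p := (leaf_iff.mp h).2.2.2.2.1

/-- A leaf pair is anomalous, hence good ORDINARY (`a_p ≡ 1 (mod p)` forces `p ∤ a_p`;
tree `Rank1Residual.goodOrd_of_anom`). [folklore] -/
theorem Leaf.goodOrd (h : Leaf W p) : GoodOrd W p := goodOrd_of_anom W p h.1.2.2.2.1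

/-- Type-A constructor: an X1 pair of type A with analytic rank `0` is on the leaf (the parity
hypothesis is redundant given `ClassX1 ∧ r = 0`, recorded for the type-A phrasing). [folklore] -/
theorem leaf_of_classX1 (hX1 : ClassX1 W p) (hr0 : W.analyticRank = 0) : Leaf W p := ⟨hX1, hr0⟩

/-! ### The statement in the shapes already in the tree -/

/-- `Statement` in the class form used by the x1a/x1b files: "for every X1 pair with
`ord_{s=1} L(E,s) = 0`, `BSD(E,p)`" — the rank-`0` half of
`Rank1ResidualX1Defs.BSDpOnClassX1`. Pure logic. [folklore] -/
theorem statement_iff_classForm : Statement ↔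
    ∀ (W : WeierstrassCurve ℚ) [W.IsElliptic] [W.IsGloballyMinimal] (p : ℕ) [Fact p.Prime],
      ClassX1 W p → W.analyticRank = 0 → BSDp W p :=
  ⟨fun h W _ _ p _ hX1 hr0 ↦ h W p ⟨hX1, hr0⟩, fun h W _ _ p _ hL ↦ h W p hL.1 hL.2⟩

/-- `Statement` in the type-A phrasing: "for every X1 pair of type A with `ord_{s=1} L(E,s) = 0`,
`BSD(E,p)`". Pure logic (`r = 0` forces type A inside X1). [folklore] -/
theorem statement_iff_typeA : Statement ↔
    ∀ (W : WeierstrassCurve ℚ) [W.IsElliptic] [W.IsGloballyMinimal] (p : ℕ) [Fact p.Prime],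
      ClassX1 W p → ¬ GVPar W p → W.analyticRank = 0 → BSDp W p := by
  rw [statement_iff_classForm]
  constructor
  · intro h W _ _ p _ hX1 _ hr0
    exact h W p hX1 hr0
  · intro h W _ _ p _ hX1 hr0
    exact h W p hX1 (fun hgv ↦ hX1.2.2.2.2 ⟨hr0, hgv⟩) hr0

/-- The x1a typed class target `BSDpOnClassX1` (both ranks; announced by Keller–Yin, PRE) implies
the sub-cell statement. [cite: KellerYin2024, Thm. 4.2.1 (p. 22) (announced; nothing asserted)] -/
theorem statement_of_bsdpOnClassX1 (hB : BSDpOnClassX1) : Statement :=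
  fun W _ _ p _ hL ↦ hB W p hL.1 (by rw [hL.2]; exact zero_le_one)

/-- **The missing input of the sub-cell is EXACTLY Mazur's main conjecture on the leaf.** Granted
the PUBLISHED named facts Wuthrich 2014 Thm. 16 (`hW16`, Kato's divisibility integrally at a
reducible prime), Greenberg 1999 Thm. 4.1 (`hGr`), modularity with integral Manin constant (`hmod`)
and Gross–Zagier–Kolyvagin (`hGZK`): `Statement` holds IF AND ONLY IF `MazurMainConjecture W p`
(Mazur's cyclotomic main conjecture for `(E,p)`, Néron normalisation — x1a's typed input) holds at
EVERY leaf pair. This is x1b's kernel iff `Rank1Residual.X1.forall_mainConjecture_iff_forall_bsdp`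
(= x1a's `mazurMainConjectureOnX1_rankZero_iff`) re-keyed to the leaf; neither side is in print.
[cite: GreenbergLNM1716, Thm. 4.1 and §5 (closing examples)] [cite: Wuthrich2014, Thm. 16 (p. 397)] -/
theorem statement_iff_forall_mazurMainConjecture
    (hW16 : Wuthrich2014.charIdeal_dvd_padicLFunction) (hGr : greenberg_charValue_rankZero)
    (hmod : nonempty_modularParametrizationData)
    (hGZK : rank_eq_analyticRank_of_analyticRank_le_one) :
    Statement ↔
    ∀ (W : WeierstrassCurve ℚ) [W.IsElliptic] [W.IsGloballyMinimal] (p : ℕ) [Fact p.Prime],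
      Leaf W p → MazurMainConjecture W p := by
  rw [statement_iff_classForm, ← mazurMainConjectureOnX1_rankZero_iff hW16 hGr hmod hGZK]
  exact ⟨fun h W _ _ p _ hL ↦ h W p hL.1 hL.2, fun h W _ _ p _ hX1 hr0 ↦ h W p ⟨hX1, hr0⟩⟩

/-- Pair by pair: at a leaf pair, `MazurMainConjecture W p ↔ BSDp W p` (same published facts;
x1a/x1b `mazurMainConjecture_iff_bsdp`). [cite: GreenbergLNM1716, Thm. 4.1 and §5 (closing examples)]
[cite: Wuthrich2014, Thm. 16 (p. 397)] -/
theorem Leaf.mazurMainConjecture_iff_bsdp [W.IsElliptic]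
    (hW16 : Wuthrich2014.charIdeal_dvd_padicLFunction) (hGr : greenberg_charValue_rankZero)
    (hmod : nonempty_modularParametrizationData)
    (hGZK : rank_eq_analyticRank_of_analyticRank_le_one) (h : Leaf W p) :
    MazurMainConjecture W p ↔ BSDp W p :=
  Summit.BirchSwinnertonDyer.BirchSwinnertonDyer.Theorems.Rank1ResidualX1Converse.mazurMainConjecture_iff_bsdp
    hW16 hGr hmod hGZK W p h.1 h.2

/-- The x1a typed residue `MazurMainConjectureOnX1TypeA` (Mazur's main conjecture at every X1 pair
of type A, both ranks) implies the sub-cell statement, via Greenberg's Thm. 4.1, modularity and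
Gross–Zagier–Kolyvagin (x1a `bsdp_of_classX1_typeA_of_analyticRank_eq_zero`).
[cite: KellerYin2024, §0.5 (prose claim; nothing asserted)] [cite: GreenbergLNM1716, Thm. 4.1] -/
theorem statement_of_mazurMainConjectureOnX1TypeA (hA : MazurMainConjectureOnX1TypeA)
    (hGr : greenberg_charValue_rankZero) (hmod : nonempty_modularParametrizationData)
    (hGZK : rank_eq_analyticRank_of_analyticRank_le_one) : Statement :=
  fun W _ _ p _ hL ↦
    bsdp_of_classX1_typeA_of_analyticRank_eq_zero hA hGr hmod hGZK W p hL.1 hL.not_gvPar hL.2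

/-! ### The covered neighbours at `r = 0` (by name) and the rank-0 good-Eisenstein dichotomy -/

/-- **Off the leaf, a good Eisenstein pair `p > 2` of analytic rank `0` satisfies `BSD(E,p)` from
PUBLISHED theorems** — covered rows C6 (Castella–Grossi–Skinner, Math. Ann. 393 (2025) Thm. D:
`¬anom(p)`) and C7 (Greenberg–Vatsal, Invent. Math. 142 (2000) Thm. 1.3 + Greenberg LNM 1716 Thm. 4.1
+ Kato: `anom(p) ∧ gvpar(p)`), tree `Rank1Residual.bsdp_of_not_classX1` (x1a gen 6, no per-pair bit).
Named facts: `hD` (CGS Thm. D), `hGV` (GV Thm. 1.3), `hGr` (Greenberg Thm. 4.1), modularity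
(`hmod`, `hmodP`), Gross–Zagier–Kolyvagin (`hGZK`). [cite: CastellaGrossiSkinner2025, Theorem D]
[cite: GreenbergVatsal2000, Thm. (1.3)] [cite: GreenbergLNM1716, Thm. 4.1] -/
theorem bsdp_of_not_leaf [W.IsElliptic]
    (hD : CastellaGrossiSkinner2025.thmD_padicValRat_bsd_rank_le_one)
    (hGV : GreenbergVatsal2000.thm13_charIdeal_eq_of_gvPar) (hGr : greenberg_charValue_rankZero)
    (hmod : hasEntireLFunction_rat) (hmodP : nonempty_modularParametrizationData)
    (hGZK : rank_eq_analyticRank_of_analyticRank_le_one)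
    (hp : 2 < p) (hgood : Good W p) (hred : Red W p) (hr0 : W.analyticRank = 0)
    (hnot : ¬ Leaf W p) : BSDp W p :=
  bsdp_of_not_classX1 hD hGV hGr hmod hmodP hGZK W p hp hgood hred (by rw [hr0]; exact zero_le_one)
    (fun hX1 ↦ hnot ⟨hX1, hr0⟩)

/-- **The rank-0 good-Eisenstein dichotomy of the published record:** at a good Eisenstein prime
`p > 2` of a curve of analytic rank `0`, EITHER `BSD(E,p)` holds by the published theorems (C6 ∪ C7)
OR the pair is on this sub-cell's leaf — no third case, no per-pair datum.
[cite: CastellaGrossiSkinner2025, Theorem D] [cite: GreenbergVatsal2000, Thm. (1.3)] -/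
theorem bsdp_or_leaf [W.IsElliptic]
    (hD : CastellaGrossiSkinner2025.thmD_padicValRat_bsd_rank_le_one)
    (hGV : GreenbergVatsal2000.thm13_charIdeal_eq_of_gvPar) (hGr : greenberg_charValue_rankZero)
    (hmod : hasEntireLFunction_rat) (hmodP : nonempty_modularParametrizationData)
    (hGZK : rank_eq_analyticRank_of_analyticRank_le_one)
    (hp : 2 < p) (hgood : Good W p) (hred : Red W p) (hr0 : W.analyticRank = 0) :
    BSDp W p ∨ Leaf W p := by
  by_cases hL : Leaf W p
  · exact Or.inr hL
  · exact Or.inl (bsdp_of_not_leaf hD hGV hGr hmod hmodP hGZK hp hgood hred hr0 hL)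

/-- **What settling the sub-cell buys:** granted `Statement` (and the published facts), EVERY good
Eisenstein prime `p > 2` of EVERY elliptic curve over `ℚ` of analytic rank `0` satisfies `BSD(E,p)`.
[cite: CastellaGrossiSkinner2025, Theorem D] [cite: GreenbergVatsal2000, Thm. (1.3)] -/
theorem bsdp_goodEisenstein_rankZero_of_statement (hS : Statement)
    (hD : CastellaGrossiSkinner2025.thmD_padicValRat_bsd_rank_le_one)
    (hGV : GreenbergVatsal2000.thm13_charIdeal_eq_of_gvPar) (hGr : greenberg_charValue_rankZero)
    (hmod : hasEntireLFunction_rat) (hmodP : nonempty_modularParametrizationData)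
    (hGZK : rank_eq_analyticRank_of_analyticRank_le_one)
    (W : WeierstrassCurve ℚ) [W.IsElliptic] [W.IsGloballyMinimal] (p : ℕ) [Fact p.Prime]
    (hp : 2 < p) (hgood : Good W p) (hred : Red W p) (hr0 : W.analyticRank = 0) : BSDp W p :=
  (bsdp_or_leaf hD hGV hGr hmod hmodP hGZK hp hgood hred hr0).elim id (hS W p)

end Summit.BirchSwinnertonDyer.Rank1Residual.X1.RankZero

end
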